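import Summits.AtomisticToContinuum.Crystallization.Theorems.ReggeStarCoercivityDefectFreeCrystallizesLayeredGluing08

/-!
# Part 9 of the proof of `stub_layeredGluing : LayeredGluing` (S5a, line `prestress-split-korn`, crux stmt-AtomisticToContinuum-13603); see the module docstring of the final part `ReggeStarCoercivityDefectFreeCrystallizesLayeredGluing.lean` for the overview
-/

noncomputable section

open scoped BigOperators Classical InnerProductSpace
open Filter Topology

namespace Summit.AtomisticToContinuum.Crystallization.Theorems.PrestressSplitKorn

open Summit.AtomisticToContinuum.Crystallization.Theses
open Summit.AtomisticToContinuum.Crystallization.Theses.ReggeStarCoercivity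
open Summit.AtomisticToContinuum.Crystallization.Theorems.DefectFreeCrystallizes.Negative.PredicateAPI
open Literature.MathematicalPhysics.StatisticalMechanics Literature.Geometry.DiscreteGeometry


section Sites

variable {a : ℝ} {s : ℤ → ℤ} {z : ℤ → ℝ}

section GenericStep

variable {Y : Set (EuclideanSpace ℝ (Fin 3))} {q : EuclideanSpace ℝ (Fin 3)} {E : EuclideanSpace ℝ (Fin 3) ≃ₗᵢ[ℝ] (EuclideanSpace ℝ (Fin 3))} {a' : ℝ} {s' : ℤ → ℤ} {z' : ℤ → ℝ}

/-- **The tilt has `ν₂² = 1/9`.** -/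
theorem gs_nu_sq (hH : HalfFramedAt a Y q s z) (hT : TemplateAt Y q E a' s' z')
    (htilt : E.symm (layerNormal 1) ≠ layerNormal 1 ∧ E.symm (layerNormal 1) ≠ -layerNormal 1) :
    (E.symm (layerNormal 1)) 2 ^ 2 = 1 / 9 := by
  obtain ⟨haa, hc'⟩ := gs_tilted_cubic' hH hT htilt
  subst a'
  obtain ⟨φ, hφ, hinj, -⟩ := exists_phi hH hT
  obtain ⟨horth, hanti⟩ := gs_phi_facts hH hφ
  obtain ⟨hbox, hs, hz0, -, -⟩ := hH
  obtain ⟨hbox', hs', hz0', -, -⟩ := hT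
  set ν := E.symm (layerNormal 1) with hν
  have hνn : ‖ν‖ = 1 := norm_frame_normal E
  have ha := hbox.a_pos
  have hhex : ∀ l ∈ hexLabels, l ∈ nbrLabels s := fun l hl => mem_nbrLabels.2 (Or.inl hl)
  have hz1pos : 0 < z' 1 := by have := (hbox'.z_one hz0').1; linarith [hbox'.a_pos]
  have hzm1neg : z' (-1) < 0 := by have := (hbox'.z_neg_one hz0').1; linarith [hbox'.a_pos]
  -- two hexagon labels cannot both go to the template's hexagon
  have hexpair : ∀ x ∈ hexLabels, ∀ y ∈ hexLabels, x ≠ y → y ≠ -x →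
      φ x ∈ hexLabels → φ y ∈ hexLabels → False := by
    intro x hx y hy hxy hyx hφx hφy
    have o1 := horth x hx
    have o2 := horth y hy
    rw [layeredPos_of_mem_hexLabels hz0' hφx] at o1
    rw [layeredPos_of_mem_hexLabels hz0' hφy] at o2
    have hdet : ((φ x).2.1 : ℝ) * (φ y).2.2 - (φ y).2.1 * (φ x).2.2 ≠ 0 := by
      have hdet' : (φ x).2.1 * (φ y).2.2 - (φ y).2.1 * (φ x).2.2 ≠ 0 := by
        intro h0
        rcases hex_det2 _ hφx _ hφy h0 with h | h
        · exact hxy (hinj (hhex x hx) (hhex y hy) h.symm)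
        · have e1 := (hφ y (hhex y hy)).2
          rw [h, layeredPos_neg_hex hz0' hφx, map_neg, (hφ x (hhex x hx)).2,
            ← layeredPos_neg_hex hz0 hx] at e1
          exact hyx (layeredPos_injective_of_inBox hbox e1).symm
      exact_mod_cast hdet'
    have := nu_vertical hbox'.a_pos.ne' hdet o1 o2
    rcases eq_layerNormal_of_horizontal_zero hνn this.1 this.2 with h' | h'
    · exact htilt.1 h'
    · exact htilt.2 h'
  -- an upper-triangle image orthogonal to `ν` from a hexagon label not mapped to the hexagon
  have getUp : ∀ l ∈ hexLabels, φ l ∉ hexLabels → ∃ t ∈ upLabels (s' 0),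
      ⟪layeredPos a s' z' t, ν⟫_ℝ = 0 ∧ (E (layeredPos a s' z' t) = layeredPos a s z l ∨
        E (layeredPos a s' z' t) = layeredPos a s z (-l)) := by
    intro l hl hnot
    have hmem := (hφ l (hhex l hl)).1
    rcases mem_nbrLabels.1 hmem with h | h | h
    · exact absurd h hnot
    · exact ⟨φ l, h, horth l hl, Or.inl (hφ l (hhex l hl)).2⟩
    · refine ⟨φ (-l), ?_, horth (-l) (neg_mem_hexLabels hl), Or.inr (hφ (-l) (hhex _ (neg_mem_hexLabels hl))).2⟩
      have hmem' := (hφ (-l) (hhex _ (neg_mem_hexLabels hl))).1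
      have h2 := congrArg (fun x : EuclideanSpace ℝ (Fin 3) => x 2) (hanti l hl)
      simp only [PiLp.neg_apply, layeredPos_apply_two, downLabels_fst h] at h2
      rcases mem_nbrLabels.1 hmem' with h' | h' | h'
      · rw [hexLabels_fst h', hz0'] at h2; linarith
      · exact h'
      · rw [downLabels_fst h'] at h2; linarith
  -- distinct sources give distinct upper sites
  have hdist : ∀ {t₁ t₂ : ℤ × ℤ × ℤ} {l₁ l₂ : ℤ × ℤ × ℤ}, l₁ ∈ hexLabels → l₂ ∈ hexLabels →
      l₁ ≠ l₂ → l₁ ≠ -l₂ →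
      (E (layeredPos a s' z' t₁) = layeredPos a s z l₁ ∨ E (layeredPos a s' z' t₁) = layeredPos a s z (-l₁)) →
      (E (layeredPos a s' z' t₂) = layeredPos a s z l₂ ∨ E (layeredPos a s' z' t₂) = layeredPos a s z (-l₂)) →
      t₁ ≠ t₂ := by
    intro t₁ t₂ l₁ l₂ h₁ h₂ hne hne' e1 e2 heq
    rw [heq] at e1
    have key : ∀ x y : ℤ × ℤ × ℤ, layeredPos a s z x = layeredPos a s z y → x = y :=
      fun x y h => layeredPos_injective_of_inBox hbox h
    rcases e1 with e1 | e1 <;> rcases e2 with e2 | e2 <;> have h12 := key _ _ (e1.symm.trans e2)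
    · exact hne h12
    · exact hne' h12
    · apply hne'; rw [← neg_neg l₁, h12]  -- -l₁ = l₂ → l₁ = -l₂
    · apply hne; have := congrArg Neg.neg h12; simpa using this
  have hA : ((0 : ℤ), (1 : ℤ), (0 : ℤ)) ∈ hexLabels := by decide
  have hB : ((0 : ℤ), (0 : ℤ), (1 : ℤ)) ∈ hexLabels := by decide
  have hC : ((0 : ℤ), (1 : ℤ), (-1 : ℤ)) ∈ hexLabels := by decide
  have finish : ∀ l₁ l₂ : ℤ × ℤ × ℤ, l₁ ∈ hexLabels → l₂ ∈ hexLabels → l₁ ≠ l₂ → l₁ ≠ -l₂ →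
      φ l₁ ∉ hexLabels → φ l₂ ∉ hexLabels → ν 2 ^ 2 = 1 / 9 := by
    intro l₁ l₂ h₁ h₂ hne hne' hn₁ hn₂
    obtain ⟨t₁, ht₁, o₁, e₁⟩ := getUp l₁ h₁ hn₁
    obtain ⟨t₂, ht₂, o₂, e₂⟩ := getUp l₂ h₂ hn₂
    exact nu_sq_of_two_up hbox' hs' hc' hνn ht₁ ht₂ (hdist h₁ h₂ hne hne' e₁ e₂) o₁ o₂
  by_cases hφA : φ (0, 1, 0) ∈ hexLabels
  · have hφB : φ (0, 0, 1) ∉ hexLabels := fun h => hexpair _ hA _ hB (by decide) (by decide) hφA h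
    have hφC : φ (0, 1, -1) ∉ hexLabels := fun h => hexpair _ hA _ hC (by decide) (by decide) hφA h
    exact finish _ _ hB hC (by decide) (by decide) hφB hφC
  · by_cases hφB : φ (0, 0, 1) ∈ hexLabels
    · have hφC : φ (0, 1, -1) ∉ hexLabels := fun h => hexpair _ hB _ hC (by decide) (by decide) hφB h
      exact finish _ _ hA hC (by decide) (by decide) hφA hφC
    · exact finish _ _ hA hB (by decide) (by decide) hφA hφB

/-! ### Low sites of the far layers -/

/-- Auxiliary step `pick_of_sum_three` of the proof of `stub_layeredGluing` (S5a); see the final part's module docstring. -/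
theorem pick_of_sum_three {I₁ I₂ I₃ c : ℝ} (h : I₁ + I₂ + I₃ = 3 * c) : I₁ ≤ c ∨ I₂ ≤ c ∨ I₃ ≤ c := by
  by_contra hc
  push Not at hc
  linarith [hc.1, hc.2.1, hc.2.2]

/-- Auxiliary step `horiz_bound` of the proof of `stub_layeredGluing` (S5a); see the final part's module docstring. -/
theorem horiz_bound {a c₀ c₁ n₀ n₁ : ℝ} (ha : 0 < a) (hc : c₀ ^ 2 + c₁ ^ 2 ≤ a ^ 2 / 3)
    (hn : n₀ ^ 2 + n₁ ^ 2 ≤ 1) : -(3 / 5 * a) ≤ c₀ * n₀ + c₁ * n₁ := by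
  have hcs : (c₀ * n₀ + c₁ * n₁) ^ 2 ≤ (c₀ ^ 2 + c₁ ^ 2) * (n₀ ^ 2 + n₁ ^ 2) := by
    nlinarith [sq_nonneg (c₀ * n₁ - c₁ * n₀)]
  have hn0 : 0 ≤ n₀ ^ 2 + n₁ ^ 2 := by positivity
  have h1 : (c₀ * n₀ + c₁ * n₁) ^ 2 ≤ (3 / 5 * a) ^ 2 := by
    have h2 : (c₀ ^ 2 + c₁ ^ 2) * (n₀ ^ 2 + n₁ ^ 2) ≤ a ^ 2 / 3 * 1 :=
      mul_le_mul hc hn hn0 (by positivity)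
    nlinarith
  nlinarith [abs_le_of_sq_le_sq h1 (by positivity), neg_abs_le (c₀ * n₀ + c₁ * n₁)]

/-- **Low site of layer `2`.** For a unit `ν` with `ν₂² ≤ 1/9`, layer `2` has a site in the open
2-ball whose `ν`-height is at most `z 2 / 3` (and at least `-6a/5`). -/
theorem low_site_up (hbox : InBox a z) (hs : IsHaggSeq s) (hz0 : z 0 = 0) {ν : EuclideanSpace ℝ (Fin 3)}
    (hN : ν 0 ^ 2 + ν 1 ^ 2 + ν 2 ^ 2 = 1) (hν2 : ν 2 ^ 2 ≤ 1 / 9) :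
    ∃ i j : ℤ, ‖layeredPos a s z (2, i, j)‖ < 2 ∧ ⟪layeredPos a s z (2, i, j), ν⟫_ℝ ≤ z 2 / 3 ∧
      -(6 / 5 * a) ≤ ⟪layeredPos a s z (2, i, j), ν⟫_ℝ := by
  have ha := hbox.a_pos
  have ha1 := hbox.2.1
  have h3 : (√3 : ℝ) ^ 2 = 3 := Real.sq_sqrt (by norm_num)
  have hz1 := hbox.z_one hz0
  have hz12 := hbox.2.2 1
  rw [show (1 : ℤ) + 1 = 2 by norm_num] at hz12
  have hz2lo : 39 / 25 * a ≤ z 2 := by linarith [hz1.1, hz12.1]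
  have hz2hi : z 2 ≤ 17 / 10 * a := by linarith [hz1.2, hz12.2]
  have hν : -(1 / 3) ≤ ν 2 ∧ ν 2 ≤ 1 / 3 := by constructor <;> nlinarith
  have hn01 : ν 0 ^ 2 + ν 1 ^ 2 ≤ 1 := by nlinarith
  have hzν : z 2 * ν 2 ≤ z 2 / 3 ∧ -(z 2 / 3) ≤ z 2 * ν 2 := by constructor <;> nlinarith
  have hL2 := haggLabel_two s
  -- generic treatment of a candidate
  have cand : ∀ i j : ℤ, ∀ c₀ c₁ : ℝ, layeredPos a s z (2, i, j) 0 = c₀ → layeredPos a s z (2, i, j) 1 = c₁ →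
      c₀ ^ 2 + c₁ ^ 2 ≤ a ^ 2 / 3 →
      ‖layeredPos a s z (2, i, j)‖ < 2 ∧ -(6 / 5 * a) ≤ ⟪layeredPos a s z (2, i, j), ν⟫_ℝ ∧
        ⟪layeredPos a s z (2, i, j), ν⟫_ℝ = c₀ * ν 0 + c₁ * ν 1 + z 2 * ν 2 := by
    intro i j c₀ c₁ h0 h1 hc
    have hinner : ⟪layeredPos a s z (2, i, j), ν⟫_ℝ = c₀ * ν 0 + c₁ * ν 1 + z 2 * ν 2 := by
      rw [real_inner_fin3, h0, h1, layeredPos_apply_two]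
    refine ⟨?_, ?_, hinner⟩
    · apply norm_lt_two_of_sq
      rw [norm_sq_fin3, h0, h1, layeredPos_apply_two]
      nlinarith only [hc, hz2lo, hz2hi, ha, ha1]
    · rw [hinner]
      have hb := horiz_bound ha hc hn01
      linarith only [hb, hzν.2, hz2hi, ha]
  rcases hs 0 with hσ | hσ <;> rcases hs 1 with hτ | hτ
  · -- letters `+,+`: label `2`, candidates `(-1,-1), (0,-1), (-1,0)`
    have hL : haggLabel s 2 = 2 := by rw [hL2, hσ, hτ]; rfl
    obtain ⟨n1, l1, e1⟩ := cand (-1) (-1) (-(a / 2)) (-(a * √3 / 6))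
      (by rw [layeredPos_apply_zero, hL]; push_cast; ring) (by rw [layeredPos_apply_one, hL]; push_cast; ring)
      (by nlinarith only [h3, sq_nonneg a])
    obtain ⟨n2, l2, e2⟩ := cand 0 (-1) (a / 2) (-(a * √3 / 6))
      (by rw [layeredPos_apply_zero, hL]; push_cast; ring) (by rw [layeredPos_apply_one, hL]; push_cast; ring)
      (by nlinarith only [h3, sq_nonneg a])
    obtain ⟨n3, l3, e3⟩ := cand (-1) 0 0 (a * √3 / 3)
      (by rw [layeredPos_apply_zero, hL]; push_cast; ring) (by rw [layeredPos_apply_one, hL]; push_cast; ring)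
      (by nlinarith only [h3, sq_nonneg a])
    have hsum : ⟪layeredPos a s z (2, -1, -1), ν⟫_ℝ + ⟪layeredPos a s z (2, 0, -1), ν⟫_ℝ +
        ⟪layeredPos a s z (2, -1, 0), ν⟫_ℝ = 3 * (z 2 * ν 2) := by rw [e1, e2, e3]; ring
    rcases pick_of_sum_three hsum with h | h | h
    · exact ⟨-1, -1, n1, h.trans hzν.1, l1⟩
    · exact ⟨0, -1, n2, h.trans hzν.1, l2⟩
    · exact ⟨-1, 0, n3, h.trans hzν.1, l3⟩
  · -- letters `+,-`: label `0`, candidate `(0,0)`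
    have hL : haggLabel s 2 = 0 := by rw [hL2, hσ, hτ]; rfl
    obtain ⟨n1, l1, e1⟩ := cand 0 0 0 0
      (by rw [layeredPos_apply_zero, hL]; push_cast; ring) (by rw [layeredPos_apply_one, hL]; push_cast; ring)
      (by nlinarith only [sq_nonneg a])
    exact ⟨0, 0, n1, by rw [e1]; linarith [hzν.1], l1⟩
  · -- letters `-,+`: label `0`
    have hL : haggLabel s 2 = 0 := by rw [hL2, hσ, hτ]; rfl
    obtain ⟨n1, l1, e1⟩ := cand 0 0 0 0
      (by rw [layeredPos_apply_zero, hL]; push_cast; ring) (by rw [layeredPos_apply_one, hL]; push_cast; ring)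
      (by nlinarith only [sq_nonneg a])
    exact ⟨0, 0, n1, by rw [e1]; linarith [hzν.1], l1⟩
  · -- letters `-,-`: label `-2`, candidates `(1,1), (0,1), (1,0)`
    have hL : haggLabel s 2 = -2 := by rw [hL2, hσ, hτ]; rfl
    obtain ⟨n1, l1, e1⟩ := cand 1 1 (a / 2) (a * √3 / 6)
      (by rw [layeredPos_apply_zero, hL]; push_cast; ring) (by rw [layeredPos_apply_one, hL]; push_cast; ring)
      (by nlinarith only [h3, sq_nonneg a])
    obtain ⟨n2, l2, e2⟩ := cand 0 1 (-(a / 2)) (a * √3 / 6)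
      (by rw [layeredPos_apply_zero, hL]; push_cast; ring) (by rw [layeredPos_apply_one, hL]; push_cast; ring)
      (by nlinarith only [h3, sq_nonneg a])
    obtain ⟨n3, l3, e3⟩ := cand 1 0 0 (-(a * √3 / 3))
      (by rw [layeredPos_apply_zero, hL]; push_cast; ring) (by rw [layeredPos_apply_one, hL]; push_cast; ring)
      (by nlinarith only [h3, sq_nonneg a])
    have hsum : ⟪layeredPos a s z (2, 1, 1), ν⟫_ℝ + ⟪layeredPos a s z (2, 0, 1), ν⟫_ℝ +
        ⟪layeredPos a s z (2, 1, 0), ν⟫_ℝ = 3 * (z 2 * ν 2) := by rw [e1, e2, e3]; ring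
    rcases pick_of_sum_three hsum with h | h | h
    · exact ⟨1, 1, n1, h.trans hzν.1, l1⟩
    · exact ⟨0, 1, n2, h.trans hzν.1, l2⟩
    · exact ⟨1, 0, n3, h.trans hzν.1, l3⟩

/-- **Low site of layer `-2`.** -/
theorem low_site_down (hbox : InBox a z) (hs : IsHaggSeq s) (hz0 : z 0 = 0) {ν : EuclideanSpace ℝ (Fin 3)}
    (hN : ν 0 ^ 2 + ν 1 ^ 2 + ν 2 ^ 2 = 1) (hν2 : ν 2 ^ 2 ≤ 1 / 9) :
    ∃ i j : ℤ, ‖layeredPos a s z (-2, i, j)‖ < 2 ∧ ⟪layeredPos a s z (-2, i, j), ν⟫_ℝ ≤ -z (-2) / 3 ∧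
      -(6 / 5 * a) ≤ ⟪layeredPos a s z (-2, i, j), ν⟫_ℝ := by
  have ha := hbox.a_pos
  have ha1 := hbox.2.1
  have h3 : (√3 : ℝ) ^ 2 = 3 := Real.sq_sqrt (by norm_num)
  have hz1 := hbox.z_neg_one hz0
  have hz12 := hbox.2.2 (-2)
  rw [show (-2 : ℤ) + 1 = -1 by norm_num] at hz12
  have hz2lo : 39 / 25 * a ≤ -z (-2) := by linarith [hz1.1, hz12.1]
  have hz2hi : -z (-2) ≤ 17 / 10 * a := by linarith [hz1.2, hz12.2]
  have hν : -(1 / 3) ≤ ν 2 ∧ ν 2 ≤ 1 / 3 := by constructor <;> nlinarith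
  have hn01 : ν 0 ^ 2 + ν 1 ^ 2 ≤ 1 := by nlinarith
  have hzν : z (-2) * ν 2 ≤ -z (-2) / 3 ∧ -(-z (-2) / 3) ≤ z (-2) * ν 2 := by constructor <;> nlinarith
  have hL2 := haggLabel_neg_two s
  have cand : ∀ i j : ℤ, ∀ c₀ c₁ : ℝ, layeredPos a s z (-2, i, j) 0 = c₀ → layeredPos a s z (-2, i, j) 1 = c₁ →
      c₀ ^ 2 + c₁ ^ 2 ≤ a ^ 2 / 3 →
      ‖layeredPos a s z (-2, i, j)‖ < 2 ∧ -(6 / 5 * a) ≤ ⟪layeredPos a s z (-2, i, j), ν⟫_ℝ ∧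
        ⟪layeredPos a s z (-2, i, j), ν⟫_ℝ = c₀ * ν 0 + c₁ * ν 1 + z (-2) * ν 2 := by
    intro i j c₀ c₁ h0 h1 hc
    have hinner : ⟪layeredPos a s z (-2, i, j), ν⟫_ℝ = c₀ * ν 0 + c₁ * ν 1 + z (-2) * ν 2 := by
      rw [real_inner_fin3, h0, h1, layeredPos_apply_two]
    refine ⟨?_, ?_, hinner⟩
    · apply norm_lt_two_of_sq
      rw [norm_sq_fin3, h0, h1, layeredPos_apply_two]
      nlinarith only [hc, hz2lo, hz2hi, ha, ha1]
    · rw [hinner]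
      have hb := horiz_bound ha hc hn01
      linarith only [hb, hzν.2, hz2hi, ha]
  rcases hs (-1) with hσ | hσ <;> rcases hs (-2) with hτ | hτ
  · -- label `-2`: candidates `(1,1), (0,1), (1,0)`
    have hL : haggLabel s (-2) = -2 := by rw [hL2, hσ, hτ]; rfl
    obtain ⟨n1, l1, e1⟩ := cand 1 1 (a / 2) (a * √3 / 6)
      (by rw [layeredPos_apply_zero, hL]; push_cast; ring) (by rw [layeredPos_apply_one, hL]; push_cast; ring)
      (by nlinarith only [h3, sq_nonneg a])
    obtain ⟨n2, l2, e2⟩ := cand 0 1 (-(a / 2)) (a * √3 / 6)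
      (by rw [layeredPos_apply_zero, hL]; push_cast; ring) (by rw [layeredPos_apply_one, hL]; push_cast; ring)
      (by nlinarith only [h3, sq_nonneg a])
    obtain ⟨n3, l3, e3⟩ := cand 1 0 0 (-(a * √3 / 3))
      (by rw [layeredPos_apply_zero, hL]; push_cast; ring) (by rw [layeredPos_apply_one, hL]; push_cast; ring)
      (by nlinarith only [h3, sq_nonneg a])
    have hsum : ⟪layeredPos a s z (-2, 1, 1), ν⟫_ℝ + ⟪layeredPos a s z (-2, 0, 1), ν⟫_ℝ +
        ⟪layeredPos a s z (-2, 1, 0), ν⟫_ℝ = 3 * (z (-2) * ν 2) := by rw [e1, e2, e3]; ring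
    rcases pick_of_sum_three hsum with h | h | h
    · exact ⟨1, 1, n1, h.trans hzν.1, l1⟩
    · exact ⟨0, 1, n2, h.trans hzν.1, l2⟩
    · exact ⟨1, 0, n3, h.trans hzν.1, l3⟩
  · have hL : haggLabel s (-2) = 0 := by rw [hL2, hσ, hτ]; rfl
    obtain ⟨n1, l1, e1⟩ := cand 0 0 0 0
      (by rw [layeredPos_apply_zero, hL]; push_cast; ring) (by rw [layeredPos_apply_one, hL]; push_cast; ring)
      (by nlinarith only [sq_nonneg a])
    exact ⟨0, 0, n1, by rw [e1]; linarith [hzν.1], l1⟩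
  · have hL : haggLabel s (-2) = 0 := by rw [hL2, hσ, hτ]; rfl
    obtain ⟨n1, l1, e1⟩ := cand 0 0 0 0
      (by rw [layeredPos_apply_zero, hL]; push_cast; ring) (by rw [layeredPos_apply_one, hL]; push_cast; ring)
      (by nlinarith only [sq_nonneg a])
    exact ⟨0, 0, n1, by rw [e1]; linarith [hzν.1], l1⟩
  · -- label `2`: candidates `(-1,-1), (0,-1), (-1,0)`
    have hL : haggLabel s (-2) = 2 := by rw [hL2, hσ, hτ]; rfl
    obtain ⟨n1, l1, e1⟩ := cand (-1) (-1) (-(a / 2)) (-(a * √3 / 6))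
      (by rw [layeredPos_apply_zero, hL]; push_cast; ring) (by rw [layeredPos_apply_one, hL]; push_cast; ring)
      (by nlinarith only [h3, sq_nonneg a])
    obtain ⟨n2, l2, e2⟩ := cand 0 (-1) (a / 2) (-(a * √3 / 6))
      (by rw [layeredPos_apply_zero, hL]; push_cast; ring) (by rw [layeredPos_apply_one, hL]; push_cast; ring)
      (by nlinarith only [h3, sq_nonneg a])
    obtain ⟨n3, l3, e3⟩ := cand (-1) 0 0 (a * √3 / 3)
      (by rw [layeredPos_apply_zero, hL]; push_cast; ring) (by rw [layeredPos_apply_one, hL]; push_cast; ring)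
      (by nlinarith only [h3, sq_nonneg a])
    have hsum : ⟪layeredPos a s z (-2, -1, -1), ν⟫_ℝ + ⟪layeredPos a s z (-2, 0, -1), ν⟫_ℝ +
        ⟪layeredPos a s z (-2, -1, 0), ν⟫_ℝ = 3 * (z (-2) * ν 2) := by rw [e1, e2, e3]; ring
    rcases pick_of_sum_three hsum with h | h | h
    · exact ⟨-1, -1, n1, h.trans hzν.1, l1⟩
    · exact ⟨0, -1, n2, h.trans hzν.1, l2⟩
    · exact ⟨-1, 0, n3, h.trans hzν.1, l3⟩

/-! ### The far layers of a tilted template are ideal -/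

/-- Auxiliary step `fcc_decomp` of the proof of `stub_layeredGluing` (S5a); see the final part's module docstring. -/
theorem fcc_decomp (a : ℝ) (σ m i j : ℤ) :
    layeredPos a (fun _ => σ) (idealZ a) (m, i, j) =
      (i : ℝ) • layeredPos a (fun _ => σ) (idealZ a) (0, 1, 0) +
        (j : ℝ) • layeredPos a (fun _ => σ) (idealZ a) (0, 0, 1) +
        (m : ℝ) • layeredPos a (fun _ => σ) (idealZ a) (1, 0, 0) := by
  simp only [layeredPos_fcc]
  push_cast
  module

/-- The layer index of an ideal height in `[39a/25, 17a/10]` is `2`. -/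
theorem eq_two_of_idealZ_mem {a : ℝ} (ha : 0 < a) {m : ℤ} (hlo : 39 / 25 * a ≤ idealZ a m)
    (hhi : idealZ a m ≤ 17 / 10 * a) : m = 2 := by
  have hb := sqrt_two_thirds_bounds
  simp only [idealZ] at hlo hhi
  have k1 : 39 / 25 ≤ (m : ℝ) * Real.sqrt (2 / 3) := le_of_mul_le_mul_right (by linarith) ha
  have k2 : (m : ℝ) * Real.sqrt (2 / 3) ≤ 17 / 10 := le_of_mul_le_mul_right (by linarith) ha
  rcases lt_trichotomy m 2 with h | h | h
  · exfalso
    have : (m : ℝ) ≤ 1 := by exact_mod_cast (show m ≤ 1 by omega)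
    nlinarith
  · exact h
  · exfalso
    have : (3 : ℝ) ≤ m := by exact_mod_cast (show 3 ≤ m by omega)
    nlinarith

/-- Auxiliary step `eq_neg_two_of_idealZ_mem` of the proof of `stub_layeredGluing` (S5a); see the final part's module docstring. -/
theorem eq_neg_two_of_idealZ_mem {a : ℝ} (ha : 0 < a) {m : ℤ} (hlo : 39 / 25 * a ≤ -idealZ a m)
    (hhi : -idealZ a m ≤ 17 / 10 * a) : m = -2 := by
  have h : idealZ a (-m) = -idealZ a m := by simp [idealZ]
  have := eq_two_of_idealZ_mem ha (m := -m) (by rw [h]; exact hlo) (by rw [h]; exact hhi)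
  omega

/-- Landing anchor of this file (registered stub of crux stmt-AtomisticToContinuum-13603; re-exports a result above). -/
theorem layeredGluing_part09_anchor :
    ∀ (I₁ I₂ I₃ c : ℝ), I₁ + I₂ + I₃ = 3 * c → I₁ ≤ c ∨ I₂ ≤ c ∨ I₃ ≤ c :=
  fun _ _ _ _ h => pick_of_sum_three h

end GenericStep
end Sites

end Summit.AtomisticToContinuum.Crystallization.Theorems.PrestressSplitKorn
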